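import Literature.MathematicalPhysics.QuantumFieldTheory.Balaban1983to89.T4HaarSU2ExpChart
import HarnessLib

/-!
# The one-link Jacobian bound for a CLASS-ANGLE SHIFT on `SU(2)`: shifting the class angle by `θ` on a shell `a ≤ ‖x‖ ≤ b` of the exponential chart
# changes Haar weights by at most `sup sin²r / sin²(r+θ)`

Support module (`--supports` stmt-QuantumFields-23948; memo HOME `bc/g14-dw/PLAN-PERIODIC.md` §C «(OL)»: the one analytic brick for the strip cruxes
⟨23957⟩/⟨23949⟩ in the untwisted seam sector and for the core estimate's line of the transported own axis).  ABSTRACT in the shift: for any measurable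
`ψ : SU(2) → SU(2)` which ON THE CHART SHELL `{a ≤ ‖x‖ ≤ b}` moves along rays, `ψ(exp(ι(r ω))) = exp(ι((r + θ) ω))` (`‖ω‖ = 1`, `r ∈ [a, b]`; e.g. the
own-axis shift `W ↦ exp(θ · axis(W)) · W`), with `0 < a`, `0 < a + θ`, `b + θ < π`, and any constant `ρ ≥ 0` with `sin² r ≤ ρ · sin²(r + θ)` on `[a, b]`
(`ρ = 1` for a shift AWAY from the identity inside the first quadrant, `b + θ ≤ π/2`, `θ ≥ 0`):

  ★ `lintegral_indicator_comp_shift_le`:  `∫ 𝟙_{exp(ι shell)}(U) · F(ψ U) dHaar(U) ≤ ρ · ∫ F dHaar`   for every measurable `F ≥ 0`.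

Proof: Haar in the exponential chart is `(2π²)⁻¹ sinc²‖x‖ d³x` on the ball `‖x‖ < π` (Lit `T4HaarSU2ExpChart.lintegral_haarProbability_su2_exp`, the
window identified through `injOn_expPoint`), polar coordinates (`lintegral_eq_lintegral_toSphere_three`, `r² sinc² r = sin² r`), the one-dimensional
translation `r ↦ r + θ` (Lebesgue measure on `ℝ` is translation invariant), and the pointwise weight comparison `sin² r ≤ ρ sin²(r + θ)`.
HONEST FRAMING: a change-of-variables inequality on one compact group; nothing about lattice gauge theory, infinite volume, the continuum limit or the
Clay gap.  No `sorry`, no new axiom, no new definition.  References: [folklore] (Haar measure of `SU(2) ≅ S³` in exponential coordinates; e.g.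
Montvay–Münster (3.96)–(3.97) for orientation, not cited).
-/

set_option autoImplicit false

noncomputable section

open MeasureTheory MeasureTheory.Measure Set Metric Function
open scoped ENNReal Real

namespace Summit.QuantumFields.YangMills.Theorems.FemtoTransferGap.ClassShift

open Literature.MathematicalPhysics.QuantumFieldTheory (haarProbability)
open Literature.MathematicalPhysics.QuantumFieldTheory.Balaban1983to89.T4HaarSU2ExpChart

/-- The chart shell `{a ≤ ‖x‖ ≤ b}` is measurable. [folklore] -/
theorem measurableSet_shell (a b : ℝ) : MeasurableSet {x : EuclideanSpace ℝ (Fin 3) | a ≤ ‖x‖ ∧ ‖x‖ ≤ b} :=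
  (measurableSet_le measurable_const continuous_norm.measurable).inter (measurableSet_le continuous_norm.measurable measurable_const)

/-- The chart shell lies in the injectivity ball when `b < π`. [folklore] -/
theorem shell_subset_ball {a b : ℝ} (hb : b < π) : {x : EuclideanSpace ℝ (Fin 3) | a ≤ ‖x‖ ∧ ‖x‖ ≤ b} ⊆ ball (0 : EuclideanSpace ℝ (Fin 3)) π :=
  fun _ hx => mem_ball_zero_iff.2 (lt_of_le_of_lt hx.2 hb)

/-- On the chart ball the window indicator is the shell indicator: `𝟙_{exp(ι S)}(exp(ι x)) = 𝟙_S(x)` for `‖x‖ < π` (injectivity of the chart).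
[folklore] -/
theorem indicator_image_expPoint {a b : ℝ} (hb : b < π) (G : Matrix.specialUnitaryGroup (Fin 2) ℂ → ℝ≥0∞) {x : EuclideanSpace ℝ (Fin 3)}
    (hx : x ∈ ball (0 : EuclideanSpace ℝ (Fin 3)) π) :
    (expPoint '' {y : EuclideanSpace ℝ (Fin 3) | a ≤ ‖y‖ ∧ ‖y‖ ≤ b}).indicator G (expPoint x) =
      {y : EuclideanSpace ℝ (Fin 3) | a ≤ ‖y‖ ∧ ‖y‖ ≤ b}.indicator (fun y => G (expPoint y)) x := by
  by_cases hxS : x ∈ {y : EuclideanSpace ℝ (Fin 3) | a ≤ ‖y‖ ∧ ‖y‖ ≤ b}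
  · rw [indicator_of_mem (mem_image_of_mem _ hxS), indicator_of_mem hxS]
  · rw [indicator_of_notMem hxS, indicator_of_notMem]
    rintro ⟨y, hy, hyx⟩
    exact hxS (injOn_expPoint (shell_subset_ball hb hy) hx hyx ▸ hy)

/-- ★ **The class-angle shift inequality.**  Let `ψ : SU(2) → SU(2)` be measurable and move the exponential-chart shell `a ≤ ‖x‖ ≤ b` along rays by `θ`:
`ψ(exp(ι(r ω))) = exp(ι((r+θ) ω))` for unit `ω` and `r ∈ [a, b]`, where `0 < a + θ`, `b + θ < π` (and `b < π`); and let `ρ ≥ 0` satisfy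
`sin² r ≤ ρ · sin²(r + θ)` for `r ∈ [a, b]`.  Then for every measurable `F : SU(2) → [0,∞]`,
`∫ 𝟙_{exp(ι shell)}(U) F(ψ U) dHaar(U) ≤ ρ ∫ F dHaar`. [folklore] -/
theorem lintegral_indicator_comp_shift_le {ψ : Matrix.specialUnitaryGroup (Fin 2) ℂ → Matrix.specialUnitaryGroup (Fin 2) ℂ} (hψ : Measurable ψ)
    {θ a b ρ : ℝ} (hbπ : b < π) (haθ : 0 < a + θ) (hbθ : b + θ < π) (hρ : 0 ≤ ρ)
    (hray : ∀ ω : EuclideanSpace ℝ (Fin 3), ‖ω‖ = 1 → ∀ r : ℝ, a ≤ r → r ≤ b → ψ (expPoint (r • ω)) = expPoint ((r + θ) • ω))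
    (hsin : ∀ r : ℝ, a ≤ r → r ≤ b → Real.sin r ^ 2 ≤ ρ * Real.sin (r + θ) ^ 2)
    (F : Matrix.specialUnitaryGroup (Fin 2) ℂ → ℝ≥0∞) (hF : Measurable F) :
    ∫⁻ U, (expPoint '' {x : EuclideanSpace ℝ (Fin 3) | a ≤ ‖x‖ ∧ ‖x‖ ≤ b}).indicator (fun U => F (ψ U)) U
        ∂(haarProbability (Matrix.specialUnitaryGroup (Fin 2) ℂ)) ≤
      ENNReal.ofReal ρ * ∫⁻ U, F U ∂(haarProbability (Matrix.specialUnitaryGroup (Fin 2) ℂ)) := by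
  set S : Set (EuclideanSpace ℝ (Fin 3)) := {x | a ≤ ‖x‖ ∧ ‖x‖ ≤ b} with hSdef
  have hS : MeasurableSet S := measurableSet_shell a b
  have hSball : S ⊆ ball (0 : EuclideanSpace ℝ (Fin 3)) π := shell_subset_ball hbπ
  have hW : MeasurableSet (expPoint '' S) := measurableSet_image_expPoint hS hSball
  have hGm : Measurable fun U => (expPoint '' S).indicator (fun U => F (ψ U)) U := (hF.comp hψ).indicator hW
  -- the two chart integrands on `ℝ³`
  set H₁ : EuclideanSpace ℝ (Fin 3) → ℝ≥0∞ := S.indicator fun x => F (ψ (expPoint x)) * ENNReal.ofReal (Real.sinc ‖x‖ ^ 2) with hH₁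
  set H₂ : EuclideanSpace ℝ (Fin 3) → ℝ≥0∞ :=
    (ball (0 : EuclideanSpace ℝ (Fin 3)) π).indicator fun x => F (expPoint x) * ENNReal.ofReal (Real.sinc ‖x‖ ^ 2) with hH₂
  have hsincm : Measurable fun x : EuclideanSpace ℝ (Fin 3) => ENNReal.ofReal (Real.sinc ‖x‖ ^ 2) :=
    ((Real.continuous_sinc.comp continuous_norm).pow 2).measurable.ennreal_ofReal
  have hH₁m : Measurable H₁ := (((hF.comp hψ).comp measurable_expPoint).mul hsincm).indicator hS
  have hH₂m : Measurable H₂ := ((hF.comp measurable_expPoint).mul hsincm).indicator measurableSet_ball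
  -- Step 1: both sides through the chart
  have hL : ∫⁻ U, (expPoint '' S).indicator (fun U => F (ψ U)) U ∂(haarProbability (Matrix.specialUnitaryGroup (Fin 2) ℂ)) =
      ENNReal.ofReal (1 / (2 * π ^ 2)) * ∫⁻ x, H₁ x := by
    rw [lintegral_haarProbability_su2_exp _ hGm, ← lintegral_indicator measurableSet_ball]
    congr 1
    refine lintegral_congr fun x => ?_
    by_cases hx : x ∈ ball (0 : EuclideanSpace ℝ (Fin 3)) π
    · rw [indicator_of_mem hx, indicator_image_expPoint hbπ _ hx, hH₁]
      by_cases hxS : x ∈ S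
      · rw [indicator_of_mem hxS, indicator_of_mem hxS]
      · rw [indicator_of_notMem hxS, indicator_of_notMem hxS, zero_mul]
    · rw [indicator_of_notMem hx, hH₁, indicator_of_notMem fun h => hx (hSball h)]
  have hR : ∫⁻ U, F U ∂(haarProbability (Matrix.specialUnitaryGroup (Fin 2) ℂ)) = ENNReal.ofReal (1 / (2 * π ^ 2)) * ∫⁻ x, H₂ x := by
    rw [lintegral_haarProbability_su2_exp _ hF, ← lintegral_indicator measurableSet_ball]
  -- Step 2: the inequality on ONE ray `ω`, `‖ω‖ = 1`
  have hrayint : ∀ ω : sphere (0 : EuclideanSpace ℝ (Fin 3)) 1,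
      ∫⁻ r in Ioi (0 : ℝ), ENNReal.ofReal (r ^ 2) * H₁ (r • (ω : EuclideanSpace ℝ (Fin 3))) ≤
        ENNReal.ofReal ρ * ∫⁻ r in Ioi (0 : ℝ), ENNReal.ofReal (r ^ 2) * H₂ (r • (ω : EuclideanSpace ℝ (Fin 3))) := by
    intro ω
    have hω : ‖(ω : EuclideanSpace ℝ (Fin 3))‖ = 1 := by simp
    -- the shifted profile `K(u) = 𝟙[a+θ, b+θ](u) sin²u F(exp(ι(u ω)))`
    set K : ℝ → ℝ≥0∞ := (Icc (a + θ) (b + θ)).indicator fun u =>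
      ENNReal.ofReal (Real.sin u ^ 2) * F (expPoint (u • (ω : EuclideanSpace ℝ (Fin 3)))) with hK
    have hnorm : ∀ r : ℝ, 0 < r → ‖r • (ω : EuclideanSpace ℝ (Fin 3))‖ = r := fun r hr => by
      rw [norm_smul, hω, mul_one, Real.norm_of_nonneg hr.le]
    -- (2a) pointwise on `(0, ∞)`: `r² H₁(rω) ≤ ρ · K(r + θ)`
    have h2a : ∀ r ∈ Ioi (0 : ℝ), ENNReal.ofReal (r ^ 2) * H₁ (r • (ω : EuclideanSpace ℝ (Fin 3))) ≤ ENNReal.ofReal ρ * K (r + θ) := by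
      intro r hr
      have hr0 : 0 < r := hr
      by_cases hrS : a ≤ r ∧ r ≤ b
      · have hmem : r • (ω : EuclideanSpace ℝ (Fin 3)) ∈ S := by
          show a ≤ ‖r • (ω : EuclideanSpace ℝ (Fin 3))‖ ∧ ‖r • (ω : EuclideanSpace ℝ (Fin 3))‖ ≤ b
          rw [hnorm r hr0]; exact hrS
        have hmem' : r + θ ∈ Icc (a + θ) (b + θ) := ⟨by linarith [hrS.1], by linarith [hrS.2]⟩
        rw [hH₁, indicator_of_mem hmem, hK, indicator_of_mem hmem', hnorm r hr0, hray _ hω r hrS.1 hrS.2]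
        calc ENNReal.ofReal (r ^ 2) * (F (expPoint ((r + θ) • (ω : EuclideanSpace ℝ (Fin 3)))) * ENNReal.ofReal (Real.sinc r ^ 2))
            = ENNReal.ofReal (Real.sin r ^ 2) * F (expPoint ((r + θ) • (ω : EuclideanSpace ℝ (Fin 3)))) := by
              rw [mul_comm (F _), ← mul_assoc, ← ENNReal.ofReal_mul (sq_nonneg _), sq_mul_sinc_sq hr0.ne']
          _ ≤ ENNReal.ofReal (ρ * Real.sin (r + θ) ^ 2) * F (expPoint ((r + θ) • (ω : EuclideanSpace ℝ (Fin 3)))) :=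
              mul_le_mul' (ENNReal.ofReal_le_ofReal (hsin r hrS.1 hrS.2)) le_rfl
          _ = ENNReal.ofReal ρ * (ENNReal.ofReal (Real.sin (r + θ) ^ 2) * F (expPoint ((r + θ) • (ω : EuclideanSpace ℝ (Fin 3))))) := by
              rw [ENNReal.ofReal_mul hρ, mul_assoc]
      · have hnot : r • (ω : EuclideanSpace ℝ (Fin 3)) ∉ S := by
          intro h
          apply hrS
          have h' : a ≤ ‖r • (ω : EuclideanSpace ℝ (Fin 3))‖ ∧ ‖r • (ω : EuclideanSpace ℝ (Fin 3))‖ ≤ b := h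
          rwa [hnorm r hr0] at h'
        rw [hH₁, indicator_of_notMem hnot, mul_zero]
        exact bot_le
    -- (2b) pointwise: `K(u) ≤ 𝟙_{(0,∞)}(u) · u² H₂(u ω)`
    have h2b : ∀ u : ℝ, K u ≤ (Ioi (0 : ℝ)).indicator (fun u => ENNReal.ofReal (u ^ 2) * H₂ (u • (ω : EuclideanSpace ℝ (Fin 3)))) u := by
      intro u
      by_cases hu : u ∈ Icc (a + θ) (b + θ)
      · have hu0 : 0 < u := lt_of_lt_of_le haθ hu.1
        have huπ : u < π := lt_of_le_of_lt hu.2 hbθ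
        have hball : u • (ω : EuclideanSpace ℝ (Fin 3)) ∈ ball (0 : EuclideanSpace ℝ (Fin 3)) π := by
          rw [mem_ball_zero_iff, hnorm u hu0]; exact huπ
        rw [hK, indicator_of_mem hu, indicator_of_mem (show u ∈ Ioi (0 : ℝ) from hu0), hH₂, indicator_of_mem hball, hnorm u hu0,
          mul_comm (F _), ← mul_assoc, ← ENNReal.ofReal_mul (sq_nonneg _), sq_mul_sinc_sq hu0.ne']
      · rw [hK, indicator_of_notMem hu]; exact bot_le
    -- (2c) assemble along the ray: translation invariance of Lebesgue measure on `ℝ`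
    calc ∫⁻ r in Ioi (0 : ℝ), ENNReal.ofReal (r ^ 2) * H₁ (r • (ω : EuclideanSpace ℝ (Fin 3)))
        ≤ ∫⁻ r in Ioi (0 : ℝ), ENNReal.ofReal ρ * K (r + θ) := setLIntegral_mono' measurableSet_Ioi h2a
      _ ≤ ∫⁻ r, ENNReal.ofReal ρ * K (r + θ) := setLIntegral_le_lintegral _ _
      _ = ENNReal.ofReal ρ * ∫⁻ r, K (r + θ) := lintegral_const_mul' _ _ ENNReal.ofReal_ne_top
      _ = ENNReal.ofReal ρ * ∫⁻ u, K u := by rw [lintegral_add_right_eq_self K θ]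
      _ ≤ ENNReal.ofReal ρ * ∫⁻ u, (Ioi (0 : ℝ)).indicator (fun u => ENNReal.ofReal (u ^ 2) * H₂ (u • (ω : EuclideanSpace ℝ (Fin 3)))) u :=
          mul_le_mul' le_rfl (lintegral_mono h2b)
      _ = ENNReal.ofReal ρ * ∫⁻ u in Ioi (0 : ℝ), ENNReal.ofReal (u ^ 2) * H₂ (u • (ω : EuclideanSpace ℝ (Fin 3))) := by
          rw [lintegral_indicator measurableSet_Ioi]

  -- Step 3: assemble through the chart and polar coordinates
  rw [hL, hR, lintegral_eq_lintegral_toSphere_three H₁ hH₁m, lintegral_eq_lintegral_toSphere_three H₂ hH₂m]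
  calc ENNReal.ofReal (1 / (2 * π ^ 2)) *
        ∫⁻ ω, (∫⁻ r in Ioi (0 : ℝ), ENNReal.ofReal (r ^ 2) * H₁ (r • (ω : EuclideanSpace ℝ (Fin 3))))
          ∂(volume : Measure (EuclideanSpace ℝ (Fin 3))).toSphere
      ≤ ENNReal.ofReal (1 / (2 * π ^ 2)) *
        ∫⁻ ω, (ENNReal.ofReal ρ * ∫⁻ r in Ioi (0 : ℝ), ENNReal.ofReal (r ^ 2) * H₂ (r • (ω : EuclideanSpace ℝ (Fin 3))))
          ∂(volume : Measure (EuclideanSpace ℝ (Fin 3))).toSphere := mul_le_mul' le_rfl (lintegral_mono fun ω => hrayint ω)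
    _ = ENNReal.ofReal ρ * (ENNReal.ofReal (1 / (2 * π ^ 2)) *
        ∫⁻ ω, (∫⁻ r in Ioi (0 : ℝ), ENNReal.ofReal (r ^ 2) * H₂ (r • (ω : EuclideanSpace ℝ (Fin 3))))
          ∂(volume : Measure (EuclideanSpace ℝ (Fin 3))).toSphere) := by
        rw [lintegral_const_mul' _ _ ENNReal.ofReal_ne_top]; ring

/-- **The away-from-the-identity case** (`θ ≥ 0`, `b + θ ≤ π/2`): the constant is `ρ = 1` — shifting class angles away from `1` inside the first
quadrant never raises Haar weight (`sin` is increasing on `[0, π/2]`). [folklore] -/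
theorem sin_sq_le_sin_sq_add {θ a b : ℝ} (hθ : 0 ≤ θ) (ha : 0 ≤ a) (hbθ : b + θ ≤ π / 2) (r : ℝ) (har : a ≤ r) (hrb : r ≤ b) :
    Real.sin r ^ 2 ≤ 1 * Real.sin (r + θ) ^ 2 := by
  rw [one_mul]
  have h0 : 0 ≤ Real.sin r := Real.sin_nonneg_of_nonneg_of_le_pi (by linarith) (by linarith [Real.pi_pos])
  have h1 : Real.sin r ≤ Real.sin (r + θ) :=
    Real.strictMonoOn_sin.monotoneOn ⟨by linarith [Real.pi_pos], by linarith⟩ ⟨by linarith [Real.pi_pos], by linarith⟩ (by linarith)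
  exact pow_le_pow_left₀ h0 h1 2

end Summit.QuantumFields.YangMills.Theorems.FemtoTransferGap.ClassShift

end
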